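import Mathlib.Combinatorics.SimpleGraph.Clique
import Mathlib.Combinatorics.SimpleGraph.Maps
import Mathlib.Data.Finset.Sort
import Mathlib.Data.Nat.Factorial.Basic
import Literature.NumberTheory.Sieve.PolymathBoundedGaps
import HarnessLib

/-!
# The graph Dickson–Hardy–Littlewood property `GraphDHL T`

A common generalisation of the prime-pair conjectures and of Polymath's weak
Dickson–Hardy–Littlewood claim `DHL[k, 2]` (`Literature.NumberTheory.Sieve.WeakDicksonHardyLittlewood`,
Polymath 8b, Claim 3.1): fix `k` linear forms `n + h₀, …, n + h_{k-1}` (an *injective* tuple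
`h : Fin k → ℤ` whose value set is admissible) and a **target graph** `T` on the index set `Fin k`.
`GraphDHL T` says: for every such tuple, for infinitely many `n` SOME EDGE `{i, j}` of `T` is a prime
pair, i.e. `n + h_i` and `n + h_j` are both (positive) primes.

* `T = ⊤` (the complete graph `K_k`): `GraphDHL ⊤ ↔ DHL[k, 2]` (`graphDHL_top_iff`);
* `k = 2`, `T = K₂`: the prime-pair conjecture for every even difference `h₁ - h₀` (in the
  existence form "infinitely often");
* the path `0 – 2 – 6` on `{0, 2, 6}` is Polymath's "`H₁ ≤ 4`" target set, the 5-cycle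
  `SimpleGraph.cycleGraph 5` is the pentagon target of route `TargetGraphParity`.

The notion is folklore bookkeeping (a disjunction of prime-pair problems indexed by the edges of a
graph); the only published ingredient is `DHL[k, j]` [Polymath8b2014, Claim 3.1].  The phrasing of
"`n + h_i` is prime" — `0 < (n : ℤ) + h i ∧ ((n : ℤ) + h i).toNat.Prime` — and of "infinitely many
`n`" — `∃ᶠ n : ℕ in atTop` — is byte-identical with `WeakDicksonHardyLittlewood`, so that the two
notions interoperate by `rfl`.

## Contents (all proved)

* `GraphDHL T` — the definition; `graphDHL_iff` (unfolding, `Iff.rfl`).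
* `GraphDHL.of_hom` — **monotonicity along injective graph homomorphisms** `φ : T' →g T`:
  `GraphDHL T' → GraphDHL T` (restrict the tuple along `φ`; a sub-tuple of an admissible tuple is
  admissible since `ν_p` is monotone; a prime edge of `T'` maps to a prime edge of `T`).  Corollaries
  `GraphDHL.of_embedding`, `GraphDHL.mono` (`T ≤ T'`), `graphDHL_congr` (isomorphism invariance).
* `graphDHL_top_iff` — `GraphDHL (⊤ : SimpleGraph (Fin k)) ↔ WeakDicksonHardyLittlewood k 2`.
* `GraphDHL.of_weakDHL` — **pigeonhole**: if every `T`-independent finset has `≤ m` vertices then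
  `DHL[k, m+1]` implies `GraphDHL T` (`m + 1` primes among the `k` forms occupy a non-independent
  index set); `GraphDHL.of_weakDHL_of_isIndepSet` is the same with Mathlib's `SimpleGraph.IsIndepSet`.
* Non-vacuity: `exists_injective_isAdmissibleTuple` (the tuple `i ↦ i · k!` is injective and
  admissible for every `k`), hence `GraphDHL.ne_bot` / `not_graphDHL_bot` — a target graph without
  edges never has the property, so `GraphDHL` is not trivially true.

## Design notes

* The vertex type is `Fin k` (not a general `Fintype`), because `DHL[k, j]` is indexed by `k` and the
  requesting route states all its items over `SimpleGraph (Fin k)`; general finite vertex types are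
  reached through `graphDHL_congr` and `SimpleGraph.overFin`-style relabellings if ever needed.
* Tuples are injective maps `Fin k → ℤ` rather than `k`-element finsets so that the graph can be
  indexed by the forms; `graphDHL_top_iff` is the dictionary with the finset language of `DHL`.
* Deliberately NOT here: any conditional or unconditional *instance* of `GraphDHL` beyond the
  dictionary (`DHL[50, 2]`, i.e. `GraphDHL (⊤ : SimpleGraph (Fin 50))` under Bombieri–Vinogradov, is
  `weakDHL_fifty_two` + `graphDHL_top_iff`); parity obstructions live in
  `Literature/Barriers/Parity/`.

## References

* D. H. J. Polymath, *Variants of the Selberg sieve, and bounded intervals containing many primes*,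
  Res. Math. Sci. 1 (2014), Art. 12; arXiv:1407.4897, Claim 3.1 (`DHL[k, j]`) and §8 (targets
  `{0, 2}`, `{0, 2, 6}`). [Polymath8b2014]
-/

open Filter Finset

namespace Literature.NumberTheory.Sieve

variable {k k' : ℕ}

/-- **Graph Dickson–Hardy–Littlewood property** of a target graph `T` on `Fin k`: for every
injective tuple `h : Fin k → ℤ` with admissible value set `{h₀, …, h_{k-1}}`, there are infinitely
many `n : ℕ` for which some edge `{i, j}` of `T` is a *prime pair*: `n + h_i` and `n + h_j` are both
positive primes.  For `T = ⊤` this is Polymath's `DHL[k, 2]` (`graphDHL_top_iff`); for `k = 2` and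
the single edge it is the prime-pair conjecture with difference `h₁ - h₀`; the inlined form of this
predicate is the conclusion of the items of route `Parity/TargetGraphParity`.  Folklore bookkeeping
around [Polymath8b2014, Claim 3.1]. [folklore] -/
def GraphDHL {k : ℕ} (T : SimpleGraph (Fin k)) : Prop :=
  ∀ h : Fin k → ℤ, Function.Injective h →
    Literature.NumberTheory.Sieve.IsAdmissibleTuple (Finset.univ.image h) →
      ∃ᶠ n : ℕ in Filter.atTop, ∃ i j : Fin k, T.Adj i j ∧
        (0 < (n : ℤ) + h i ∧ ((n : ℤ) + h i).toNat.Prime) ∧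
          (0 < (n : ℤ) + h j ∧ ((n : ℤ) + h j).toNat.Prime)

/-- Unfolding lemma for `GraphDHL` (by `Iff.rfl`). [folklore] -/
theorem graphDHL_iff (T : SimpleGraph (Fin k)) :
    GraphDHL T ↔ ∀ h : Fin k → ℤ, Function.Injective h →
      IsAdmissibleTuple (Finset.univ.image h) →
        ∃ᶠ n : ℕ in atTop, ∃ i j : Fin k, T.Adj i j ∧
          (0 < (n : ℤ) + h i ∧ ((n : ℤ) + h i).toNat.Prime) ∧
            (0 < (n : ℤ) + h j ∧ ((n : ℤ) + h j).toNat.Prime) :=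
  Iff.rfl

/-! ### Monotonicity along injective homomorphisms -/

/-- **`GraphDHL` is monotone along injective graph homomorphisms.**  If `φ : T' →g T` is injective
on vertices and `GraphDHL T'` holds, then `GraphDHL T` holds: given an injective admissible tuple
`h` for `T`, the restricted tuple `h ∘ φ` is injective, its value set is a sub-tuple of that of `h`
and hence admissible (`ν_p` can only drop), and a prime edge `{i, j}` of `T'` for `h ∘ φ` is the
prime edge `{φ i, φ j}` of `T` for `h`.  (Used with `φ` an odd cycle of a non-bipartite `T`.) [folklore] -/
theorem GraphDHL.of_hom {T' : SimpleGraph (Fin k')} {T : SimpleGraph (Fin k)} (hT' : GraphDHL T')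
    (φ : T' →g T) (hφ : Function.Injective φ) : GraphDHL T := by
  intro h hh hadm
  have hsub : (univ.image (h ∘ φ) : Finset ℤ) ⊆ univ.image h := by
    intro x hx
    obtain ⟨i, -, rfl⟩ := mem_image.1 hx
    exact mem_image.2 ⟨φ i, mem_univ _, rfl⟩
  have hadm' : IsAdmissibleTuple (univ.image (h ∘ φ)) := fun p hp =>
    (card_le_card (image_subset_image hsub)).trans_lt (hadm p hp)
  refine (hT' (h ∘ φ) (hh.comp hφ) hadm').mono fun n hn => ?_
  obtain ⟨i, j, hij, hi, hj⟩ := hn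
  exact ⟨φ i, φ j, φ.map_adj hij, hi, hj⟩

/-- `GraphDHL` transfers along graph embeddings `T' ↪g T`. [folklore] -/
theorem GraphDHL.of_embedding {T' : SimpleGraph (Fin k')} {T : SimpleGraph (Fin k)}
    (hT' : GraphDHL T') (φ : T' ↪g T) : GraphDHL T :=
  hT'.of_hom φ.toHom φ.injective

/-- `GraphDHL` is monotone in the target graph: more edges make the disjunction weaker.
[folklore] -/
theorem GraphDHL.mono {T T' : SimpleGraph (Fin k)} (hT : GraphDHL T) (hle : T ≤ T') :
    GraphDHL T' :=
  hT.of_hom (SimpleGraph.Hom.ofLE hle) fun _ _ h => h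

/-- `GraphDHL` is invariant under graph isomorphism (relabelling the forms). [folklore] -/
theorem graphDHL_congr {T : SimpleGraph (Fin k)} {T' : SimpleGraph (Fin k')} (e : T ≃g T') :
    GraphDHL T ↔ GraphDHL T' :=
  ⟨fun h => h.of_embedding e.toEmbedding, fun h => h.of_embedding e.symm.toEmbedding⟩

/-! ### The complete graph: `GraphDHL ⊤ ↔ DHL[k, 2]` -/

/-- For an injective tuple `h : Fin k → ℤ`, the number of values `h i` satisfying a predicate equals
the number of indices `i` satisfying it. [folklore] -/
theorem card_filter_image_univ_of_injective {h : Fin k → ℤ} (hh : Function.Injective h)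
    (P : ℤ → Prop) [DecidablePred P] :
    #((univ.image h).filter P) = #(univ.filter fun i => P (h i)) := by
  rw [filter_image, card_image_of_injective _ hh]

/-- **`GraphDHL ⊤ ↔ DHL[k, 2]`.**  On the complete target graph, "some edge is a prime pair" says
"two distinct forms are simultaneously prime", which for an injective tuple is "the value set
contains at least two primes" — Polymath's `DHL[k, 2]` (`WeakDicksonHardyLittlewood k 2`,
[Polymath8b2014, Claim 3.1]); conversely every admissible `k`-element `H ⊆ ℤ` is the value set of
the injective tuple `H.orderEmbOfFin`. [folklore] -/
theorem graphDHL_top_iff : GraphDHL (⊤ : SimpleGraph (Fin k)) ↔ WeakDicksonHardyLittlewood k 2 := by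
  constructor
  · intro hG H hH hk
    set h : Fin k → ℤ := fun i => H.orderEmbOfFin hk i with hdef
    have hh : Function.Injective h := (H.orderEmbOfFin hk).injective
    have himg : univ.image h = H := H.image_orderEmbOfFin_univ hk
    refine (hG h hh (himg ▸ hH)).mono fun n hn => ?_
    obtain ⟨i, j, hij, hi, hj⟩ := hn
    rw [SimpleGraph.top_adj] at hij
    rw [← himg]
    refine one_lt_card.2 ⟨h i, ?_, h j, ?_, hh.ne hij⟩
    · exact mem_filter.2 ⟨mem_image_of_mem _ (mem_univ _), hi⟩
    · exact mem_filter.2 ⟨mem_image_of_mem _ (mem_univ _), hj⟩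
  · intro hD h hh hadm
    have hk : #(univ.image h) = k := by
      rw [card_image_of_injective _ hh, card_univ, Fintype.card_fin]
    refine (hD _ hadm hk).mono fun n hn => ?_
    obtain ⟨a, ha, b, hb, hab⟩ := one_lt_card.1 hn
    obtain ⟨ha, hpa⟩ := mem_filter.1 ha
    obtain ⟨hb, hpb⟩ := mem_filter.1 hb
    obtain ⟨i, -, rfl⟩ := mem_image.1 ha
    obtain ⟨j, -, rfl⟩ := mem_image.1 hb
    exact ⟨i, j, (SimpleGraph.top_adj i j).2 fun hij => hab (congrArg h hij), hpa, hpb⟩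

/-! ### Pigeonhole: `DHL[k, m+1]` and independence number `≤ m` -/

/-- **Pigeonhole (`DHL[k, m+1]` ⟹ `GraphDHL T` when `α(T) ≤ m`).**  If every finset of pairwise
non-adjacent vertices of `T` has at most `m` elements, then `DHL[k, m+1]`
(`WeakDicksonHardyLittlewood k (m + 1)`, [Polymath8b2014, Claim 3.1]) implies `GraphDHL T`: the
`m + 1` indices `i` with `n + h_i` prime cannot be independent, so two of them are adjacent.
Instances: `T = ⊤` with `m = 1`; the triangle `cycleGraph 3 = ⊤`; `K₅₀` unconditionally via
`weakDHL_fifty_two`.  The independence hypothesis is spelled exactly as in item `PigeonholeDHL` of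
route `Parity/TargetGraphParity`. [folklore] -/
theorem GraphDHL.of_weakDHL {m : ℕ} {T : SimpleGraph (Fin k)}
    (hα : ∀ s : Finset (Fin k), (∀ i ∈ s, ∀ j ∈ s, ¬ T.Adj i j) → s.card ≤ m)
    (hDHL : WeakDicksonHardyLittlewood k (m + 1)) : GraphDHL T := by
  classical
  intro h hh hadm
  have hk : #(univ.image h) = k := by
    rw [card_image_of_injective _ hh, card_univ, Fintype.card_fin]
  refine (hDHL _ hadm hk).mono fun n hn => ?_
  set s : Finset (Fin k) :=
    univ.filter fun i => 0 < (n : ℤ) + h i ∧ ((n : ℤ) + h i).toNat.Prime with hs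
  have hcard : m + 1 ≤ s.card := by
    rwa [hs, ← card_filter_image_univ_of_injective hh
      (fun x : ℤ => 0 < (n : ℤ) + x ∧ ((n : ℤ) + x).toNat.Prime)]
  by_contra hno
  have hle : s.card ≤ m :=
    hα s fun i hi j hj hij => hno ⟨i, j, hij, (mem_filter.1 hi).2, (mem_filter.1 hj).2⟩
  omega

/-- The pigeonhole lemma with Mathlib's `SimpleGraph.IsIndepSet`: if every independent finset of `T`
has at most `m` vertices then `DHL[k, m+1]` implies `GraphDHL T`. [folklore] -/
theorem GraphDHL.of_weakDHL_of_isIndepSet {m : ℕ} {T : SimpleGraph (Fin k)}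
    (hα : ∀ s : Finset (Fin k), T.IsIndepSet ↑s → s.card ≤ m)
    (hDHL : WeakDicksonHardyLittlewood k (m + 1)) : GraphDHL T := by
  refine GraphDHL.of_weakDHL (fun s hs => hα s fun i hi j hj _ => hs i hi j hj) hDHL

/-! ### Non-vacuity: admissible injective tuples exist, so edgeless targets fail -/

/-- For every `k` there is an injective `k`-tuple with admissible value set, e.g. `hᵢ = i · k!`:
modulo a prime `p ≤ k` every value is `≡ 0`, and modulo `p > k` at most `k < p` classes are met.
[folklore] -/
theorem exists_injective_isAdmissibleTuple (k : ℕ) :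
    ∃ h : Fin k → ℤ, Function.Injective h ∧ IsAdmissibleTuple (univ.image h) := by
  refine ⟨fun i => (i : ℤ) * (k.factorial : ℤ), fun i j hij => ?_, ?_⟩
  · have hk : (k.factorial : ℤ) ≠ 0 := by exact_mod_cast k.factorial_ne_zero
    exact Fin.ext (by exact_mod_cast mul_right_cancel₀ hk hij)
  · rw [isAdmissibleTuple_iff_of_le_card]
    intro p hp hpk
    have hpk' : p ≤ k := hpk.trans (card_image_le.trans (by simp))
    have hdvd : (p : ℤ) ∣ (k.factorial : ℤ) := by
      exact_mod_cast Nat.dvd_factorial hp.pos hpk'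
    -- every value is `≡ 0 (mod p)`, so at most one residue class is met
    have hle : tupleResidueCount (univ.image fun i : Fin k => (i : ℤ) * (k.factorial : ℤ)) p ≤ 1 := by
      unfold tupleResidueCount
      refine card_le_one.2 fun a ha b hb => ?_
      simp only [mem_image, mem_univ, true_and] at ha hb
      obtain ⟨x, ⟨i, rfl⟩, rfl⟩ := ha
      obtain ⟨y, ⟨j, rfl⟩, rfl⟩ := hb
      have h0 : ∀ i : Fin k, (((i : ℤ) * (k.factorial : ℤ) : ℤ) : ZMod p) = 0 := fun i => by
        rw [ZMod.intCast_zmod_eq_zero_iff_dvd]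
        exact hdvd.mul_left _
      rw [h0, h0]
    exact hle.trans_lt hp.one_lt

/-- A target graph with the graph Dickson–Hardy–Littlewood property has an edge (apply the property
to any injective admissible tuple). In particular `GraphDHL` is not vacuously true. [folklore] -/
theorem GraphDHL.ne_bot {T : SimpleGraph (Fin k)} (hT : GraphDHL T) : T ≠ ⊥ := by
  rintro rfl
  obtain ⟨h, hh, hadm⟩ := exists_injective_isAdmissibleTuple k
  have := hT h hh hadm
  simp only [SimpleGraph.bot_adj, false_and, exists_false, Filter.frequently_false] at this

/-- The edgeless target graph never has the graph Dickson–Hardy–Littlewood property. [folklore] -/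
theorem not_graphDHL_bot : ¬ GraphDHL (⊥ : SimpleGraph (Fin k)) := fun h => h.ne_bot rfl

end Literature.NumberTheory.Sieve
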